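import Literature.NumberTheory.Automorphic.PosRootGroupDimension
import Literature.NumberTheory.Automorphic.RootSpaceLine
import HarnessLib

/-!
# `chevalley_isomorphism` from step 1 of Springer's proof and `𝔤^T ⊆ L(T)` only
(trunk T-AUTOMORPHIC, G25 AutomorphicL; DAG of `Literature.NumberTheory.Automorphic.chevalley_isomorphism`)

Assembly file (namespace `Literature.NumberTheory.Automorphic`) on top of `RootSpaceLine.lean`
(`dim 𝔤_α ≤ 1`, hence `rootSubgroup_unique` and 8.1.3 (ii), from `𝔤^T ⊆ L(T)` in characteristic
`0`) and `PosRootGroupDimension.lean` (Springer 8.2.1 from `rootSubgroup_unique`;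
`chevalley_isomorphism_of_eq_prod` through `RootProductRetraction.lean`). Proved:

* `posRootGroup_eq_prod_of_lieWeightSpace_one_le` — the named fact `posRootGroup_eq_prod` (8.2.1,
  surjectivity) from `lieWeightSpace_one_le_lieAlgebraGL G T`;
* **`chevalley_isomorphism_of_lieWeightSpace_one_le`** — the named fact
  `Literature.NumberTheory.Automorphic.chevalley_isomorphism` (existence in Springer 9.6.2, in the
  characteristic `0` of the statement) follows from `chevalley_isomorphism_abstract` (step 1 of
  Springer's proof: the presentation 9.4.3 with 9.5.4) and `lieWeightSpace_one_le_lieAlgebraGL`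
  (`𝔤^T ⊆ L(T)`, Springer 5.4.7 with 7.6.4 (ii)) for `(G, T)` and for `(G', T')`. These two named
  facts are the whole remaining trust base of `chevalley_isomorphism`.

## References

* [SpringerLAG1998] T. A. Springer, *Linear Algebraic Groups*, 2nd ed., Progress in
  Mathematics 9, Birkhäuser (1998): Cor. 5.4.7, Cor. 7.6.4 (ii), 8.1.1 (i), Cor. 8.1.2,
  Cor. 8.1.3 (ii), Prop. 8.2.1, 8.3.11, 9.4.3, 9.5.4, Thm. 9.6.2 (proof).
-/

noncomputable section

open scoped MatrixGroups IsMulCommutative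

namespace Literature.NumberTheory.Automorphic

section Consequences

variable {k : Type*} [Field k] {n : Type*} [Fintype n] [DecidableEq n]
variable {ι X Y : Type*} [AddCommGroup X] [AddCommGroup Y]
variable {G T : Subgroup (GL n k)} [IsMulCommutative ↥T]

/-- **Springer 8.2.1 (`posRootGroup_eq_prod`) from `𝔤^T ⊆ L(T)` alone**, characteristic `0`.
[cite: SpringerLAG1998, Prop. 8.2.1] -/
theorem posRootGroup_eq_prod_of_lieWeightSpace_one_le [CharZero k]
    (h0 : lieWeightSpace_one_le_lieAlgebraGL G T) :
    posRootGroup_eq_prod (k := k) (ι := ι) (X := X) (Y := Y) G T := by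
  intro _ _ hG hT P eX eY h u hu y hy l hl hl' g hg
  exact posRootGroup_eq_prod_of_rootSubgroup_unique
    (rootSubgroup_unique_of_lieWeightSpace_one_le hG hT (h0 hG hT) h) hG hT h u hu y hy l hl hl' g hg

end Consequences

end Literature.NumberTheory.Automorphic

/-! ### Assembly: `chevalley_isomorphism` from step 1 and `𝔤^T ⊆ L(T)` -/

namespace Literature.NumberTheory.Automorphic

variable {k : Type*} [Field k]
variable {ι X Y : Type*} [AddCommGroup X] [AddCommGroup Y]
variable {N N' : ℕ} {G T : Subgroup (GL (Fin N) k)} {G' T' : Subgroup (GL (Fin N') k)}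
  [IsMulCommutative ↥T] [IsMulCommutative ↥T']

/-- **`chevalley_isomorphism` from step 1 of Springer's proof of 9.6.2 (the abstract isomorphism
`chevalley_isomorphism_abstract`) and `𝔤^T ⊆ L(T)` (`lieWeightSpace_one_le_lieAlgebraGL`,
Springer 5.4.7 with 7.6.4 (ii)) for `(G, T)` and `(G', T')` only.** In the characteristic `0` of
the statement, `𝔤^T ⊆ L(T)` gives `dim 𝔤_α = 1` (`finrank_lieWeightSpace_le_one_of_lieWeightSpace_one_le`),
whence the uniqueness of root subgroups 8.1.1 (i), the product structure 8.2.1 of `U(y)`, the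
dimension formula 8.1.3 (ii), the open big cell 8.3.11 and step 2 of the proof of 9.6.2
(`chevalley_isomorphism_of_eq_prod`, `bigCell_nhds_one_of_zdim`).
[cite: SpringerLAG1998, 9.6.2 (proof) with 8.1.1 (i), 8.1.2, 8.1.3 (ii), 8.2.1, 8.3.11, 5.4.7, 7.6.4 (ii)] -/
theorem chevalley_isomorphism_of_lieWeightSpace_one_le
    (hA : chevalley_isomorphism_abstract (k := k) (ι := ι) (X := X) (Y := Y) (G := G) (T := T)
      (G' := G') (T' := T'))
    (h0 : lieWeightSpace_one_le_lieAlgebraGL G T) (h0' : lieWeightSpace_one_le_lieAlgebraGL G' T') :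
    chevalley_isomorphism (k := k) (ι := ι) (X := X) (Y := Y) (G := G) (T := T) (G' := G')
      (T' := T') := by
  intro _ _ hG hT hG' hT' P eX eY eX' eY' h h'
  exact chevalley_isomorphism_of_eq_prod hA (posRootGroup_eq_prod_of_lieWeightSpace_one_le h0)
    (bigCell_nhds_one_of_zdim (zdim_eq_rank_add_card_roots_of_lieWeightSpace_one_le h0))
    (posRootGroup_eq_prod_of_lieWeightSpace_one_le h0')
    (bigCell_nhds_one_of_zdim (zdim_eq_rank_add_card_roots_of_lieWeightSpace_one_le h0'))
    hG hT hG' hT' h h'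

end Literature.NumberTheory.Automorphic
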